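import Summits.Ventures.PercRepro.ThetaOmegaSplit

/-!
# The two-point base of (Ω)

Dossier proofs/MINE1-theoremS.md, Addendum 80 (mine-1, gen 41). On a ground set with at most two
points, a family with at least three members satisfies the (Ω)-bound whatever its colourings.
The statement on `Fin 2` is a finite check — the four subsets, the five families with at least
three members, the `4^4` colourings — decided by the kernel (`omegaBase_fin2_col4`, with the
colourings given by their four values, `col4`); since the (Ω)-count only depends on the colours of
the members (`omegaCount_congr`) this is the full statement on `Fin 2` (`omegaBase_fin2`), and an
injection `Fin 2 ↪ α` carries it to every two-point ground set (`omegaCount_map`, `omegaBase`).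
With `conjOmega_of_base_of_goodPoint` this leaves the good-point property alone:
`conjOmega_of_goodPoint : OmegaGoodPoint α → ConjOmega α`.
-/

namespace PercRepro.MSTight

open Finset

variable {α : Type*} [DecidableEq α]

section Congr

variable {U : Finset α} {F : Finset (Finset α)} {c0 c1 c0' c1' : Finset α → Bool}

/-- The `A`-family only depends on the colours of the members. -/
theorem omegaA_congr (h0 : ∀ s ∈ F, c0 s = c0' s) (h1 : ∀ s ∈ F, c1 s = c1' s) :
    omegaA F c0 c1 = omegaA F c0' c1' := by
  ext E
  simp only [mem_omegaA]
  constructor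
  · rintro (⟨s, hs, t, ht, hst, hc, rfl⟩ | ⟨s, hs, t, ht, hc, rfl⟩)
    · exact Or.inl ⟨s, hs, t, ht, hst, by rw [← h0 s hs, ← h0 t ht, hc], rfl⟩
    · exact Or.inr ⟨s, hs, t, ht, by rw [← h0 s hs, ← h1 t ht, hc], rfl⟩
  · rintro (⟨s, hs, t, ht, hst, hc, rfl⟩ | ⟨s, hs, t, ht, hc, rfl⟩)
    · exact Or.inl ⟨s, hs, t, ht, hst, by rw [h0 s hs, h0 t ht, hc], rfl⟩
    · exact Or.inr ⟨s, hs, t, ht, by rw [h0 s hs, h1 t ht, hc], rfl⟩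

/-- The `C`-family only depends on the second colours of the members. -/
theorem omegaC_congr (h1 : ∀ s ∈ F, c1 s = c1' s) : omegaC U F c1 = omegaC U F c1' := by
  ext E
  simp only [mem_omegaC]
  constructor
  · rintro ⟨s, hs, t, ht, hst, hc, rfl⟩
    exact ⟨s, hs, t, ht, hst, by rw [← h1 s hs, ← h1 t ht, hc], rfl⟩
  · rintro ⟨s, hs, t, ht, hst, hc, rfl⟩
    exact ⟨s, hs, t, ht, hst, by rw [h1 s hs, h1 t ht, hc], rfl⟩

/-- The (Ω)-count only depends on the colours of the members. -/
theorem omegaCount_congr (h0 : ∀ s ∈ F, c0 s = c0' s) (h1 : ∀ s ∈ F, c1 s = c1' s) :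
    omegaCount U F c0 c1 = omegaCount U F c0' c1' := by
  unfold omegaCount
  rw [omegaA_congr h0 h1, omegaC_congr h1]

end Congr

section Fin2

/-- A colouring of the four subsets of `Fin 2` from four Booleans. -/
def col4 (a b c d : Bool) : Finset (Fin 2) → Bool :=
  fun s => if s = ∅ then a else if s = {0} then b else if s = {1} then c else d

/-- **The two-point base on `Fin 2`, decided by the kernel**: every family of at least three
subsets of `Fin 2`, with any of the `4^4` colourings of the four subsets, satisfies the bound. -/
theorem omegaBase_fin2_col4 : ∀ F : Finset (Finset (Fin 2)), 3 ≤ F.card →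
    ∀ a0 b0 a1 b1 a2 b2 a3 b3 : Bool,
      F.card ≤ omegaCount (univ : Finset (Fin 2)) F (col4 a0 a1 a2 a3) (col4 b0 b1 b2 b3) := by
  decide

/-- The four subsets of `Fin 2`. -/
theorem fin2_subset_cases : ∀ s : Finset (Fin 2), s = ∅ ∨ s = {0} ∨ s = {1} ∨ s = {0, 1} := by
  decide

/-- Every colouring of the subsets of `Fin 2` is a `col4`. -/
theorem col4_eq (c : Finset (Fin 2) → Bool) (s : Finset (Fin 2)) :
    col4 (c ∅) (c {0}) (c {1}) (c {0, 1}) s = c s := by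
  have h1 : ({0} : Finset (Fin 2)) ≠ ∅ := by decide
  have h2 : ({1} : Finset (Fin 2)) ≠ ∅ := by decide
  have h3 : ({1} : Finset (Fin 2)) ≠ {0} := by decide
  have h4 : ({0, 1} : Finset (Fin 2)) ≠ ∅ := by decide
  have h5 : ({0, 1} : Finset (Fin 2)) ≠ {0} := by decide
  have h6 : ({0, 1} : Finset (Fin 2)) ≠ {1} := by decide
  rcases fin2_subset_cases s with rfl | rfl | rfl | rfl <;> simp [col4, h1, h2, h3, h4, h5, h6]

/-- **The two-point base on `Fin 2`** for arbitrary colourings. -/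
theorem omegaBase_fin2 (F : Finset (Finset (Fin 2))) (h3 : 3 ≤ F.card)
    (c0 c1 : Finset (Fin 2) → Bool) : F.card ≤ omegaCount (univ : Finset (Fin 2)) F c0 c1 := by
  have h := omegaBase_fin2_col4 F h3 (c0 ∅) (c1 ∅) (c0 {0}) (c1 {0}) (c0 {1}) (c1 {1})
    (c0 {0, 1}) (c1 {0, 1})
  rwa [omegaCount_congr (fun s _ => col4_eq c0 s) (fun s _ => col4_eq c1 s)] at h

end Fin2

section Transport

variable {β : Type*} [DecidableEq β]

/-- Sets transported along an embedding `f : β ↪ α`. -/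
def setEmb (f : β ↪ α) : Finset β ↪ Finset α := ⟨fun s => s.map f, map_injective f⟩

omit [DecidableEq α] [DecidableEq β] in
/-- The transport of a set is its image under the embedding. -/
theorem setEmb_apply (f : β ↪ α) (s : Finset β) : setEmb f s = s.map f := rfl

/-- The `A`-family commutes with transport. -/
theorem omegaA_map (f : β ↪ α) (F₀ : Finset (Finset β)) (c0 c1 : Finset α → Bool) :
    omegaA (F₀.map (setEmb f)) c0 c1 =
      (omegaA F₀ (fun s => c0 (s.map f)) (fun s => c1 (s.map f))).map (setEmb f) := by
  ext E
  simp only [mem_omegaA, mem_map, setEmb_apply]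
  constructor
  · rintro (⟨s, ⟨s₀, hs₀, rfl⟩, t, ⟨t₀, ht₀, rfl⟩, hst, hc, rfl⟩ |
      ⟨s, ⟨s₀, hs₀, rfl⟩, t, ⟨t₀, ht₀, rfl⟩, hc, rfl⟩)
    · refine ⟨s₀ ⊓ t₀, Or.inl ⟨s₀, hs₀, t₀, ht₀, fun h => hst (h ▸ rfl), hc, rfl⟩, ?_⟩
      rw [inf_eq_inter, inf_eq_inter, map_inter]
    · refine ⟨s₀ \ t₀, Or.inr ⟨s₀, hs₀, t₀, ht₀, hc, rfl⟩, ?_⟩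
      rw [Finset.map_sdiff]
  · rintro ⟨d, (⟨s₀, hs₀, t₀, ht₀, hst, hc, rfl⟩ | ⟨s₀, hs₀, t₀, ht₀, hc, rfl⟩), rfl⟩
    · refine Or.inl ⟨s₀.map f, ⟨s₀, hs₀, rfl⟩, t₀.map f, ⟨t₀, ht₀, rfl⟩,
        fun h => hst (map_injective f h), hc, ?_⟩
      rw [inf_eq_inter, inf_eq_inter, map_inter]
    · refine Or.inr ⟨s₀.map f, ⟨s₀, hs₀, rfl⟩, t₀.map f, ⟨t₀, ht₀, rfl⟩, hc, ?_⟩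
      rw [Finset.map_sdiff]

/-- The `C`-family commutes with transport (the ground set transported as well). -/
theorem omegaC_map (f : β ↪ α) (U₀ : Finset β) (F₀ : Finset (Finset β)) (c1 : Finset α → Bool) :
    omegaC (U₀.map f) (F₀.map (setEmb f)) c1 =
      (omegaC U₀ F₀ (fun s => c1 (s.map f))).map (setEmb f) := by
  ext E
  simp only [mem_omegaC, mem_map, setEmb_apply]
  constructor
  · rintro ⟨s, ⟨s₀, hs₀, rfl⟩, t, ⟨t₀, ht₀, rfl⟩, hst, hc, rfl⟩
    refine ⟨U₀ \ (s₀ ⊔ t₀), ⟨s₀, hs₀, t₀, ht₀, fun h => hst (h ▸ rfl), hc, rfl⟩, ?_⟩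
    rw [sup_eq_union, sup_eq_union, Finset.map_sdiff, map_union]
  · rintro ⟨d, ⟨s₀, hs₀, t₀, ht₀, hst, hc, rfl⟩, rfl⟩
    refine ⟨s₀.map f, ⟨s₀, hs₀, rfl⟩, t₀.map f, ⟨t₀, ht₀, rfl⟩, fun h => hst (map_injective f h),
      hc, ?_⟩
    rw [sup_eq_union, sup_eq_union, Finset.map_sdiff, map_union]

/-- The (Ω)-count is invariant under transport. -/
theorem omegaCount_map (f : β ↪ α) (U₀ : Finset β) (F₀ : Finset (Finset β))
    (c0 c1 : Finset α → Bool) :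
    omegaCount (U₀.map f) (F₀.map (setEmb f)) c0 c1 =
      omegaCount U₀ F₀ (fun s => c0 (s.map f)) (fun s => c1 (s.map f)) := by
  unfold omegaCount
  rw [omegaA_map, omegaC_map, card_map, card_map]

/-- The embedding `Fin 2 ↪ α` of two distinct points. -/
def pairEmb (u v : α) (huv : u ≠ v) : Fin 2 ↪ α where
  toFun := ![u, v]
  inj' := by
    intro i j h
    fin_cases i <;> fin_cases j <;> simp_all

omit [DecidableEq α] in
/-- The first point of the pair embedding. -/
theorem pairEmb_zero (u v : α) (huv : u ≠ v) : pairEmb u v huv 0 = u := rfl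

omit [DecidableEq α] in
/-- The second point of the pair embedding. -/
theorem pairEmb_one (u v : α) (huv : u ≠ v) : pairEmb u v huv 1 = v := rfl

/-- The two points are the image of `Fin 2`. -/
theorem map_univ_pairEmb (u v : α) (huv : u ≠ v) :
    (univ : Finset (Fin 2)).map (pairEmb u v huv) = {u, v} := by
  ext a
  simp only [mem_map, mem_univ, true_and, mem_insert, mem_singleton, Fin.exists_fin_two,
    pairEmb_zero, pairEmb_one]
  constructor
  · rintro (rfl | rfl)
    · exact Or.inl rfl
    · exact Or.inr rfl
  · rintro (rfl | rfl)
    · exact Or.inl rfl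
    · exact Or.inr rfl

/-- Every subset of `{u, v}` is transported from a subset of `Fin 2`. -/
theorem exists_map_of_subset_pair {u v : α} (huv : u ≠ v) {s : Finset α}
    (hs : s ⊆ {u, v}) : ∃ s₀ : Finset (Fin 2), s₀.map (pairEmb u v huv) = s := by
  refine ⟨univ.filter fun i => pairEmb u v huv i ∈ s, ?_⟩
  ext a
  simp only [mem_map, mem_filter, mem_univ, true_and, Fin.exists_fin_two, pairEmb_zero,
    pairEmb_one]
  constructor
  · rintro (⟨h, rfl⟩ | ⟨h, rfl⟩) <;> exact h
  · intro ha
    rcases mem_insert.1 (hs ha) with rfl | h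
    · exact Or.inl ⟨ha, rfl⟩
    · rw [mem_singleton] at h
      exact Or.inr ⟨h ▸ ha, h.symm⟩

/-- **The two-point base of (Ω)**: `OmegaBase α`. -/
theorem omegaBase : OmegaBase α := by
  intro U F c0 c1 hU hF h3
  -- a ground set with at most one point carries at most two subsets
  rcases Nat.lt_or_ge U.card 2 with hU1 | hU2
  · exfalso
    have hsub : F ⊆ U.powerset := fun s hs => mem_powerset.2 (hF s hs)
    have := card_le_card hsub
    rw [card_powerset] at this
    have h2 : 2 ^ U.card ≤ 2 := by
      calc 2 ^ U.card ≤ 2 ^ 1 := Nat.pow_le_pow_right (by norm_num) (by omega)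
        _ = 2 := by norm_num
    omega
  · have hc : U.card = 2 := by omega
    obtain ⟨u, v, huv, rfl⟩ := card_eq_two.1 hc
    set f := pairEmb u v huv with hf
    -- the family comes from `Fin 2`
    set F₀ : Finset (Finset (Fin 2)) := univ.filter fun s₀ => s₀.map f ∈ F with hF₀
    have hFeq : F = F₀.map (setEmb f) := by
      ext s
      simp only [hF₀, mem_map, mem_filter, mem_univ, true_and, setEmb_apply]
      constructor
      · intro hs
        obtain ⟨s₀, rfl⟩ := exists_map_of_subset_pair huv (hF s hs)
        exact ⟨s₀, hs, rfl⟩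
      · rintro ⟨s₀, hs, rfl⟩
        exact hs
    have hcard : F.card = F₀.card := by rw [hFeq, card_map]
    have hU' : ({u, v} : Finset α) = (univ : Finset (Fin 2)).map f := (map_univ_pairEmb u v huv).symm
    rw [hFeq, hU', omegaCount_map, card_map]
    exact omegaBase_fin2 F₀ (hcard ▸ h3) _ _

/-- **(Ω) follows from the good-point property alone.** -/
theorem conjOmega_of_goodPoint (hg : OmegaGoodPoint α) : ConjOmega α :=
  conjOmega_of_base_of_goodPoint omegaBase hg

end Transport

end PercRepro.MSTight
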